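import Literature.NumberTheory.Transcendental.KZMellinFibres
import Literature.NumberTheory.Transcendental.KZDominatedFamilyRelations
import Literature.NumberTheory.Transcendental.KZBallPeelingAux
import Literature.Analysis.SpecialFunctions.SelbergIntegralBasic
import HarnessLib

/-!
# Beta chains in the Kontsevich–Zagier calculus, I: the translation `(a+b)·β(a,b+1) ∼ b·β(a,b)`

Elementary move chains between Beta representations `[(0,1), t^{a-1}(1-t)^{b-1}]` on `ℝ¹`
(Kontsevich–Zagier 2001, §1.2; Andrews–Askey–Roy 1999, §1.1), stated for arbitrary
representations PINNED by their domain and by their integrand on it: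

* `KZ.betaReflection_equivalent` — `[(0,1), t^{a-1}(1-t)^{b-1}] ∼ [(0,1), t^{b-1}(1-t)^{a-1}]`,
  ONE change of variables `t ↦ 1 − t` (`KZ.of_sub_of_mem_relations_of_boxReflection`);
* `KZ.betaTranslation_equivalent` — `[(0,1), (a+b) t^{a-1}(1-t)^{b}] ∼ [(0,1), b t^{a-1}(1-t)^{b-1}]`
  for `0 < a, b ∈ ℚ`: ONE Newton–Leibniz move from the point with the primitive `t^a (1-t)^b`
  (continuous on `[0,1]`, vanishing at both ends, `ℚ`-semialgebraic), a null boundary, and ONE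
  integrand-additivity move (`(a+b) t^{a-1}(1-t)^b = b t^{a-1}(1-t)^{b-1} + (a t^{a-1}(1-t)^b −
  b t^a(1-t)^{b-1})`). This is integration by parts `a·B(a,b+1) = b·B(a+1,b)` combined with
  `B(a,b) = B(a+1,b) + B(a,b+1)`, i.e. the functional equation `Γ(x+1) = xΓ(x)` read inside the
  rules.

Supporting lemmas: the intervals `{x | x 0 ∈ (0,1)}`, `{x | x 0 ∈ [0,1]} ⊆ ℝ¹` are
`ℚ`-semialgebraic with null difference; extension of a `ℚ`-semialgebraic function on `(0,1)` by
rational endpoint values; Euler–Mellin monomials `c · t^e (1-t)^{e'}` are `ℚ`-semialgebraic.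
Everything is proved; no `def`, no named fact.
-/

noncomputable section

open MeasureTheory Set
open Literature.ModelTheory.ExponentialFields (IsSemialgebraic isSemialgebraic_univ
  isSemialgebraic_setOf_eval_pos)
open MvPolynomial (aeval X C)

namespace Literature.NumberTheory.Transcendental

namespace KZ

/-! ## The unit intervals in `ℝ¹` -/

/-- `[0,1] ⊆ ℝ¹` (first-coordinate spelling) is `ℚ`-semialgebraic. [folklore] -/
theorem isSemialgebraic_setOf_apply_mem_Icc :
    IsSemialgebraic ℚ {x : Fin 1 → ℝ | x 0 ∈ Set.Icc (0:ℝ) 1} := by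
  have h1 := Literature.ModelTheory.ExponentialFields.isSemialgebraic_setOf_eval_le (k := ℚ) (R := ℝ)
    (0 : MvPolynomial (Fin 1) ℚ) (X 0)
  have h2 := Literature.ModelTheory.ExponentialFields.isSemialgebraic_setOf_eval_le (k := ℚ) (R := ℝ)
    (X 0 : MvPolynomial (Fin 1) ℚ) 1
  have h := h1.inter h2
  simp only [map_zero, map_one, MvPolynomial.aeval_X] at h
  have hset : {x : Fin 1 → ℝ | x 0 ∈ Set.Icc (0:ℝ) 1} = {x : Fin 1 → ℝ | 0 ≤ x 0} ∩ {x | x 0 ≤ 1} := by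
    ext x
    simp
  rw [hset]
  exact h

/-- `[0,1] ∖ (0,1) ⊆ ℝ¹` is null (two points). [folklore] -/
theorem volume_setOf_Icc_diff_Ioo :
    volume ({x : Fin 1 → ℝ | x 0 ∈ Set.Icc (0:ℝ) 1} \ {x | x 0 ∈ Set.Ioo (0:ℝ) 1}) = 0 := by
  refine measure_mono_null (fun x hx => ?_)
    (measure_union_null (BallPeeling.volume_setOf_apply_eq_const 1 (0 : Fin 1) 0)
      (BallPeeling.volume_setOf_apply_eq_const 1 (0 : Fin 1) 1))
  simp only [mem_sdiff, mem_setOf_eq, mem_Icc, mem_Ioo, not_and, not_lt] at hx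
  simp only [mem_union, mem_setOf_eq]
  obtain ⟨⟨h1, h2⟩, h3⟩ := hx
  rcases h1.lt_or_eq with h1 | h1
  · exact Or.inr (le_antisymm h2 (h3 h1))
  · exact Or.inl h1.symm

/-- Transport of integrability between `S ⊆ ℝ` and `{x | x 0 ∈ S} ⊆ ℝ¹`. [folklore] -/
theorem integrableOn_setOf_apply_mem_iff {g : ℝ → ℝ} {S : Set ℝ} :  -- Literature home of the Summits-side `integrableOn_comp_apply_zero_iff`
    IntegrableOn (fun x : Fin 1 → ℝ => g (x 0)) {x | x 0 ∈ S} ↔ IntegrableOn g S :=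
  (volume_preserving_funUnique (Fin 1) ℝ).integrableOn_comp_preimage
    (MeasurableEquiv.funUnique (Fin 1) ℝ).measurableEmbedding

/-- **Extension by rational endpoint values**: a function on `ℝ¹` which is `ℚ`-semialgebraic on
`(0,1)` and takes rational values `c₀`, `c₁` at `x 0 = 0`, `x 0 = 1` is `ℚ`-semialgebraic on
`[0,1]` (the graph gains two rational points). [folklore] -/
theorem isSemialgebraicFunOn_Icc_of_Ioo {f : (Fin 1 → ℝ) → ℝ}
    (hf : IsSemialgebraicFunOn ℚ {x : Fin 1 → ℝ | x 0 ∈ Set.Ioo (0:ℝ) 1} f) (c₀ c₁ : ℚ)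
    (h0 : ∀ x : Fin 1 → ℝ, x 0 = 0 → f x = c₀) (h1 : ∀ x : Fin 1 → ℝ, x 0 = 1 → f x = c₁) :
    IsSemialgebraicFunOn ℚ {x : Fin 1 → ℝ | x 0 ∈ Set.Icc (0:ℝ) 1} f := by
  rw [isSemialgebraicFunOn_iff] at hf ⊢
  have hpt : ∀ (u c : ℚ), IsSemialgebraic ℚ
      {z : Fin (1 + 1) → ℝ | (Fin.init z : Fin 1 → ℝ) 0 = (u : ℝ) ∧ z (Fin.last 1) = (c : ℝ)} := by
    intro u c
    have h1 := Literature.ModelTheory.ExponentialFields.isSemialgebraic_setOf_eval_eq_zero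
      (k := ℚ) (R := ℝ) (MvPolynomial.X (Fin.castSucc (0 : Fin 1)) - MvPolynomial.C u :
        MvPolynomial (Fin (1 + 1)) ℚ)
    have h2 := Literature.ModelTheory.ExponentialFields.isSemialgebraic_setOf_eval_eq_zero
      (k := ℚ) (R := ℝ) (MvPolynomial.X (Fin.last 1) - MvPolynomial.C c : MvPolynomial (Fin (1 + 1)) ℚ)
    convert h1.inter h2 using 1
    ext z
    simp only [mem_setOf_eq, mem_inter_iff, map_sub, MvPolynomial.aeval_X, MvPolynomial.aeval_C,
      eq_ratCast, sub_eq_zero, Fin.init]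
  have hset : {z : Fin (1 + 1) → ℝ | (Fin.init z : Fin 1 → ℝ) ∈ {x : Fin 1 → ℝ | x 0 ∈ Set.Icc (0:ℝ) 1} ∧
        z (Fin.last 1) = f (Fin.init z)} =
      {z | (Fin.init z : Fin 1 → ℝ) ∈ {x : Fin 1 → ℝ | x 0 ∈ Set.Ioo (0:ℝ) 1} ∧
        z (Fin.last 1) = f (Fin.init z)} ∪
      {z | (Fin.init z : Fin 1 → ℝ) 0 = ((0:ℚ):ℝ) ∧ z (Fin.last 1) = (c₀:ℝ)} ∪
      {z | (Fin.init z : Fin 1 → ℝ) 0 = ((1:ℚ):ℝ) ∧ z (Fin.last 1) = (c₁:ℝ)} := by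
    ext z
    simp only [mem_union, mem_setOf_eq, mem_Icc, mem_Ioo, Rat.cast_zero, Rat.cast_one]
    constructor
    · rintro ⟨⟨hl, hr⟩, hz⟩
      rcases hl.lt_or_eq with hl | hl
      · rcases hr.lt_or_eq with hr | hr
        · exact Or.inl (Or.inl ⟨⟨hl, hr⟩, hz⟩)
        · exact Or.inr ⟨hr, by rw [hz, h1 _ hr]⟩
      · exact Or.inl (Or.inr ⟨hl.symm, by rw [hz, h0 _ hl.symm]⟩)
    · rintro ((⟨⟨hl, hr⟩, hz⟩ | ⟨hl, hz⟩) | ⟨hl, hz⟩)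
      · exact ⟨⟨hl.le, hr.le⟩, hz⟩
      · exact ⟨⟨hl.ge, by rw [hl]; exact zero_le_one⟩, by rw [hz, h0 _ hl]⟩
      · exact ⟨⟨by rw [hl]; exact zero_le_one, hl.le⟩, by rw [hz, h1 _ hl]⟩
  rw [hset]
  exact (hf.union (hpt 0 c₀)).union (hpt 1 c₁)

/-- Two-factor Euler–Mellin monomials `c · (x 0)^e · (1 − x 0)^{e'}` (`c, e, e' ∈ ℚ`) are
`ℚ`-semialgebraic on `(0,1) ⊆ ℝ¹` (`KZ.isSemialgebraicFunOn_mellinIntegrand`). [folklore] -/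
theorem isSemialgebraicFunOn_const_mul_rpow_mul_rpow (c e e' : ℚ) :
    IsSemialgebraicFunOn ℚ {x : Fin 1 → ℝ | x 0 ∈ Set.Ioo (0:ℝ) 1}
      (fun x => (c : ℝ) * ((x 0) ^ ((e : ℚ) : ℝ) * (1 - x 0) ^ ((e' : ℚ) : ℝ))) := by
  refine (isSemialgebraicFunOn_mellinIntegrand BallPeeling.isSemialgebraic_posIoo
    ![MvPolynomial.X 0, 1 - MvPolynomial.X 0] ![e, e'] c (fun x hx k => ?_)).congr fun x _ => ?_
  · have hx' : 0 < x 0 ∧ x 0 < 1 := hx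
    fin_cases k
    · simpa using hx'.1
    · simp only [Fin.mk_one, Matrix.cons_val_one, Matrix.cons_val_fin_one, map_sub, map_one,
        MvPolynomial.aeval_X, sub_pos]
      exact hx'.2
  · simp [mellinIntegrand_apply, Fin.prod_univ_two]

/-- The derivative of `t^a (1-t)^b` inside `(0,1)`. [folklore] -/
theorem hasDerivAt_rpow_mul_one_sub_rpow {a b t : ℝ} (ht : t ∈ Set.Ioo (0:ℝ) 1) :
    HasDerivAt (fun s : ℝ => s ^ a * (1 - s) ^ b)
      (a * t ^ (a - 1) * (1 - t) ^ b + t ^ a * (-1 * b * (1 - t) ^ (b - 1))) t := by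
  have h1 : HasDerivAt (fun s : ℝ => s ^ a) (a * t ^ (a - 1)) t :=
    Real.hasDerivAt_rpow_const (Or.inl ht.1.ne')
  have h2 : HasDerivAt (fun s : ℝ => (1 - s) ^ b) (-1 * b * (1 - t) ^ (b - 1)) t := by
    have h := ((hasDerivAt_id t).const_sub 1).rpow_const (p := b)
      (Or.inl (by simp only [id]; linarith [ht.2]))
    simpa using h
  exact h1.mul h2

/-! ## Symmetry: `t ↦ 1 − t` -/

/-- **`[(0,1), t^{a-1}(1-t)^{b-1}] ∼ [(0,1), t^{b-1}(1-t)^{a-1}]`** for representations pinned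
by their integrands on `(0,1)`: ONE change of variables `t ↦ 1 − t` (`|det| = 1`).
[cite: KontsevichZagier2001, §1.2 rule (2)] -/
theorem betaReflection_equivalent (α β : ℝ) (ρ ρ' : IntegralRep 1)
    (hρd : ρ.domain = {x | x 0 ∈ Set.Ioo (0:ℝ) 1})
    (hρi : Set.EqOn ρ.integrand (fun x => (x 0) ^ α * (1 - x 0) ^ β) ρ.domain)
    (hρ'd : ρ'.domain = {x | x 0 ∈ Set.Ioo (0:ℝ) 1})
    (hρ'i : Set.EqOn ρ'.integrand (fun x => (x 0) ^ β * (1 - x 0) ^ α) ρ'.domain) :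
    Equivalent ρ ρ' := by
  refine of_sub_of_mem_relations_of_boxReflection (0 : Fin 1) ?_ fun x hx => ?_
  · rw [hρd, hρ'd]
    ext x
    simp only [mem_setOf_eq, mem_preimage, boxReflection_apply_self, mem_Ioo]
    constructor <;> rintro ⟨h1, h2⟩ <;> constructor <;> linarith
  · have hx' : x 0 ∈ Set.Ioo (0:ℝ) 1 := by rw [hρd] at hx; exact hx
    have hx'' : boxReflection (0 : Fin 1) x ∈ ρ'.domain := by
      rw [hρ'd]
      show boxReflection 0 x 0 ∈ Set.Ioo (0:ℝ) 1
      rw [boxReflection_apply_self]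
      exact ⟨by linarith [hx'.2], by linarith [hx'.1]⟩
    rw [hρi hx, hρ'i hx'']
    simp only [boxReflection_apply_self, sub_sub_cancel]
    ring

/-! ## The translation `(a+b)·β(a,b+1) ∼ b·β(a,b)` (integration by parts inside the rules) -/

/-- **`[(0,1), (a+b) t^{a-1}(1-t)^{b}] ∼ [(0,1), b t^{a-1}(1-t)^{b-1}]`** for `0 < a, b ∈ ℚ` and
representations pinned by their integrands on `(0,1)`: ONE Newton–Leibniz move from the point
`ℝ⁰` (band `[0,1]`, primitive `F(t) = t^a (1-t)^b`, `F(0) = F(1) = 0`, so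
`[[0,1], F'] − [pt, 0]` is a move and `[[0,1], F'] ∈ relations`), the null boundary `{0,1}`, and
ONE integrand-additivity move on `(0,1)`:
`(a+b) t^{a-1}(1-t)^b = F'(t) + b t^{a-1}(1-t)^{b-1}` with `F' = a t^{a-1}(1-t)^b − b t^a(1-t)^{b-1}`.
Value identity: `(a+b) B(a,b+1) = b B(a,b)`. [cite: AndrewsAskeyRoy1999, §1.1] -/
theorem betaTranslation_equivalent (a b : ℚ) (ha : 0 < a) (hb : 0 < b) (ρ ρ' : IntegralRep 1)
    (hρd : ρ.domain = {x | x 0 ∈ Set.Ioo (0:ℝ) 1})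
    (hρi : Set.EqOn ρ.integrand (fun x => ((a:ℝ) + b) * ((x 0) ^ ((a:ℝ) - 1) * (1 - x 0) ^ (b:ℝ)))
      ρ.domain)
    (hρ'd : ρ'.domain = {x | x 0 ∈ Set.Ioo (0:ℝ) 1})
    (hρ'i : Set.EqOn ρ'.integrand (fun x => (b:ℝ) * ((x 0) ^ ((a:ℝ) - 1) * (1 - x 0) ^ ((b:ℝ) - 1)))
      ρ'.domain) :
    Equivalent ρ ρ' := by
  have ha' : (a:ℝ) ≠ 0 := by exact_mod_cast ha.ne'
  have hb' : (b:ℝ) ≠ 0 := by exact_mod_cast hb.ne'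
  have haR : (0:ℝ) < a := by exact_mod_cast ha
  have hbR : (0:ℝ) < b := by exact_mod_cast hb
  -- the derivative of the primitive, extended by `0` to the closed interval
  set g : ℝ → ℝ := fun t => if t ∈ Set.Ioo (0:ℝ) 1 then
      (a:ℝ) * t ^ ((a:ℝ) - 1) * (1 - t) ^ (b:ℝ) + t ^ (a:ℝ) * (-1 * (b:ℝ) * (1 - t) ^ ((b:ℝ) - 1))
    else 0 with hgdef
  have hI1 : IntegrableOn (fun t : ℝ => t ^ ((a:ℝ) - 1) * (1 - t) ^ (b:ℝ)) (Set.Ioo 0 1) := by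
    have h := (Literature.Analysis.SpecialFunctions.Selberg.integrableOn_Ioo_rpow_mul_one_sub_rpow_and_integral_eq
      haR (by linarith : (0:ℝ) < b + 1)).1
    simpa only [add_sub_cancel_right] using h
  have hI2 : IntegrableOn (fun t : ℝ => t ^ (a:ℝ) * (1 - t) ^ ((b:ℝ) - 1)) (Set.Ioo 0 1) := by
    have h := (Literature.Analysis.SpecialFunctions.Selberg.integrableOn_Ioo_rpow_mul_one_sub_rpow_and_integral_eq
      (by linarith : (0:ℝ) < a + 1) hbR).1
    simpa only [add_sub_cancel_right] using h
  have hgi : IntegrableOn g (Set.Icc (0:ℝ) 1) := by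
    rw [integrableOn_Icc_iff_integrableOn_Ioo]
    refine IntegrableOn.congr_fun ((hI1.const_mul (a:ℝ)).add (hI2.const_mul (-(b:ℝ))))
      (fun t ht => ?_) measurableSet_Ioo
    simp only [hgdef, if_pos ht, Pi.add_apply]
    ring
  have hg_sa : IsSemialgebraicFunOn ℚ {x : Fin 1 → ℝ | x 0 ∈ Set.Icc (0:ℝ) 1}
      (fun x : Fin 1 → ℝ => g (x 0)) := by
    refine isSemialgebraicFunOn_Icc_of_Ioo ?_ 0 0 (fun x hx => ?_) (fun x hx => ?_)
    · refine (IsSemialgebraicFunOn.add_holds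
        (isSemialgebraicFunOn_const_mul_rpow_mul_rpow a (a - 1) b)
        (isSemialgebraicFunOn_const_mul_rpow_mul_rpow (-b) a (b - 1))).congr fun x hx => ?_
      have hx' : x 0 ∈ Set.Ioo (0:ℝ) 1 := hx
      simp only [hgdef, if_pos hx', Pi.add_apply, Rat.cast_sub, Rat.cast_one, Rat.cast_neg]
      ring
    · have : x 0 ∉ Set.Ioo (0:ℝ) 1 := fun h => by rw [hx] at h; exact lt_irrefl _ h.1
      simp only [hgdef, if_neg this, Rat.cast_zero]
    · have : x 0 ∉ Set.Ioo (0:ℝ) 1 := fun h => by rw [hx] at h; exact lt_irrefl _ h.2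
      simp only [hgdef, if_neg this, Rat.cast_zero]
  -- the band representation `D = [[0,1], g]` and the base `Z = [pt, 0]`
  obtain ⟨D, hDd, hDi⟩ : ∃ D : IntegralRep 1, D.domain = {x : Fin 1 → ℝ | x 0 ∈ Set.Icc (0:ℝ) 1} ∧
      D.integrand = fun x => g (x 0) :=
    ⟨⟨_, _, isSemialgebraic_setOf_apply_mem_Icc, hg_sa, integrableOn_setOf_apply_mem_iff.2 hgi⟩,
      rfl, rfl⟩
  obtain ⟨Z, hZd, hZi⟩ : ∃ Z : IntegralRep 0, Z.domain = univ ∧ Z.integrand = 0 :=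
    exists_zeroRep isSemialgebraic_univ
  have hF_sa : IsSemialgebraicFunOn ℚ {x : Fin 1 → ℝ | x 0 ∈ Set.Icc (0:ℝ) 1}
      (fun z : Fin 1 → ℝ => (z 0) ^ (a:ℝ) * (1 - z 0) ^ (b:ℝ)) := by
    refine isSemialgebraicFunOn_Icc_of_Ioo ?_ 0 0 (fun x hx => ?_) (fun x hx => ?_)
    · exact (isSemialgebraicFunOn_const_mul_rpow_mul_rpow 1 a b).congr fun x _ => by
        simp only [Rat.cast_one, one_mul]
    · simp only [hx, Real.zero_rpow ha', zero_mul, Rat.cast_zero]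
    · simp only [hx, sub_self, Real.zero_rpow hb', mul_zero, Rat.cast_zero]
  have hNL : of D - of Z ∈ newtonLeibnizRel := by
    refine ⟨0, D, Z, fun _ => ((0:ℕ):ℝ), fun _ => ((0:ℕ):ℝ) + 1,
      fun z => (z (Fin.last 0)) ^ (a:ℝ) * (1 - z (Fin.last 0)) ^ (b:ℝ), by rw [hDd]; exact hF_sa,
      by rw [hZd]; exact isSemialgebraicFunOn_natCast isSemialgebraic_univ 0, ?_,
      fun _ _ => by simp, ?_, ?_, ?_, ?_, rfl⟩
    · rw [hZd]
      exact (isSemialgebraicFunOn_aeval isSemialgebraic_univ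
        (((0:ℕ) : MvPolynomial (Fin 0) ℚ) + 1)).congr fun x _ => by simp
    · rw [hDd, hZd]
      ext z
      simp only [mem_univ, true_and, mem_setOf_eq, mem_Icc, Nat.cast_zero, zero_add]
      rfl
    · intro x _
      simp only [Fin.snoc_last, Nat.cast_zero, zero_add]
      exact ((continuousOn_id.rpow_const fun t _ => Or.inr (by positivity)).mul
        ((continuousOn_const.sub continuousOn_id).rpow_const fun t _ => Or.inr (by positivity)))
    · intro x _ t ht
      simp only [Nat.cast_zero, zero_add] at ht
      simp only [Fin.snoc_last, hDi]
      rw [show (0 : Fin 1) = Fin.last 0 from rfl, Fin.snoc_last]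
      have hgt : g t = (a:ℝ) * t ^ ((a:ℝ) - 1) * (1 - t) ^ (b:ℝ) +
          t ^ (a:ℝ) * (-1 * (b:ℝ) * (1 - t) ^ ((b:ℝ) - 1)) := by simp only [hgdef, if_pos ht]
      rw [hgt]
      exact hasDerivAt_rpow_mul_one_sub_rpow ht
    · intro x _
      simp only [hZi, Pi.zero_apply, Fin.snoc_last, Nat.cast_zero, zero_add, Real.one_rpow,
        sub_self, Real.zero_rpow hb', Real.zero_rpow ha', mul_zero, zero_mul, sub_zero]
  have hZ_mem : of Z ∈ relations := of_mem_relations_of_eqOn_zero Z (by rw [hZi]; exact fun _ _ => rfl)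
  have hD_mem : of D ∈ relations := by
    have := relations.add_mem (newtonLeibnizRel_subset_relations hNL) hZ_mem
    rwa [sub_add_cancel] at this
  -- its open restriction
  have hsub : {x : Fin 1 → ℝ | x 0 ∈ Set.Ioo (0:ℝ) 1} ⊆ D.domain := by
    rw [hDd]
    exact fun x hx => ⟨hx.1.le, hx.2.le⟩
  set D₀ := D.restrict _ BallPeeling.isSemialgebraic_posIoo hsub with hD₀
  have hD₀_mem : of D₀ ∈ relations := by
    have h1 := D.of_sub_of_restrict_mem_relations BallPeeling.isSemialgebraic_posIoo hsub
      (by rw [hDd]; exact volume_setOf_Icc_diff_Ioo)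
    have := relations.sub_mem hD_mem h1
    rwa [sub_sub_cancel] at this
  -- integrand additivity on (0,1): ρ = D₀ + ρ'
  have hadd : of ρ - of D₀ - of ρ' ∈ integrandAddRel := by
    refine ⟨1, ρ, D₀, ρ', by rw [hρd]; rfl, by rw [hρ'd, hρd], fun x hx => ?_, rfl⟩
    have hx' : x 0 ∈ Set.Ioo (0:ℝ) 1 := by rw [hρd] at hx; exact hx
    have hxρ' : x ∈ ρ'.domain := by rw [hρ'd]; exact hx'
    rw [Pi.add_apply, hρi hx, hρ'i hxρ']
    simp only [hD₀, IntegralRep.integrand_restrict, hDi, hgdef, if_pos hx']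
    have ht0 : (x 0) ≠ 0 := hx'.1.ne'
    have h1t : (1 - x 0) ≠ 0 := (sub_pos.2 hx'.2).ne'
    have e1 : (x 0) ^ (a:ℝ) = (x 0) ^ ((a:ℝ) - 1) * x 0 := by
      rw [Real.rpow_sub_one ht0, div_mul_cancel₀ _ ht0]
    have e2 : (1 - x 0) ^ (b:ℝ) = (1 - x 0) ^ ((b:ℝ) - 1) * (1 - x 0) := by
      rw [Real.rpow_sub_one h1t, div_mul_cancel₀ _ h1t]
    rw [e1, e2]
    ring
  have := relations.add_mem (integrandAddRel_subset_relations hadd) hD₀_mem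
  have h' : of ρ - of D₀ - of ρ' + of D₀ = of ρ - of ρ' := by abel
  rw [h'] at this
  exact this

end KZ

end Literature.NumberTheory.Transcendental
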